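import Summits.BirchSwinnertonDyer.Rank1Residual.Additive.RamifiedOrdinaryLineTorsionFixed
import HarnessLib

/-!
# TB-TOL AT THE PLACE `v` on the (M) rows — the "conjugate-inertia glue" of n1011-p12 GEN 4 open
# item (i) is NOT needed: the Tate line of X2 already lives at `𝔓₀ = adicCompletionPrime ℚ v` for
# EVERY `v ∋ p`; hence `TwistedOrdinaryLineAt W 3 (inertia v)` on X4(M) / X3♯(M) / pot-mult(3), and
# the (M)-row TWINS of p12's FILE 7 `ClassX4Gord/ClassX3Gord.exists_isRamifiedOrdinaryLine_flipped_three`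
# (cell `b2b-bsdres`, lane CLASS-CLOSURE, seat cc-typer-1 = typer of record N11 / O8, GEN 9;
# consumer: team n1011 row T-E3g-GV29 (M) twins; p12's FILES 4/6/7 and X2's Tate data BY NAME)

HONEST FRAMING (cell `b2b-bsdres`, run/shared/lean/b2b/bsd-rank1-residual/, verbatim in every
file): the goal of the cell is to DELETE the COMBINATION-SHAPED residual classes of the
Birch–Swinnerton-Dyer formula for ALL analytic-rank `≤ 1` elliptic curves over `ℚ` — "full BSD
formula for every rank `≤ 1` curve in class `C`" assembled STRICTLY from published theorems — so
that the rank-`≤ 1` remainder becomes exactly the CONSTRUCTION-SHAPED classes, which are TYPED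
(missing-input `Prop`s), NOT attempted. This is not "finishing BSD". Lane CLASS-CLOSURE: research
routes, no claim beyond the stated classes; census output = EVIDENCE, never a Literature fact;
NOTHING is booked here. THEOREMS ONLY: no definition, no named fact, no conjecture, no `sorry`.
The (M) rows carry the PUBLISHED Tate uniformisation A40/A41 (`hT40`, `hT41`) as hypotheses, exactly
as everywhere in the X2 / AdditivePotMult kernel; nothing else.

## What and why

p12's FILE 7 (`Additive/RamifiedOrdinaryLineTorsionFixed`) discharged the four local hypotheses
`h0 / hplus / hfix / hmax` of GV Prop. (2.8) under Remark (2.9) on the X4♯(G-ord) / X3♯(G-ord) rows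
at `3`, reading `hfix` off cc-typer-1's `TwistedOrdinaryLineAt W 3 (inertia v)` (TB-TOL, gen 7). On
the (M) rows gen 7 only recorded TB-TOL at SOME prime `𝔓 ∣ 3`
(`exists_twistedOrdinaryLineAt_three_of_mult_twist_model`), and p12 listed the (M) twins as open
"needing a conjugate-inertia glue to `inertia v`". No conjugacy is needed: X2's
`IsogenyLineType.exists_line_adicCompletionPrime_of_datum` produces the Tate line at the tree's
prime `adicCompletionPrime ℚ v` of EVERY place `v ∋ p` (from `exists_data_of_split` /
`exists_data_of_not_split`), and `inertia v = I_{adicCompletionPrime ℚ v}`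
(`inertia_adicCompletionPrime_eq_map_absInertia`, Neukirch II (9.6)).

* §1 (namespace `…Additive.MixedCongruence`, next to gen 6/7's shapes):
  `unramifiedQuotientLineAt_adicCompletionPrime_of_multiplicative` /
  `unramifiedQuotientLineAt_inertia_of_multiplicative` — the Tate line of a globally minimal
  multiplicative `E'` at the odd prime `p`, AT THE PLACE (`∀ v ∋ p`);
  `twistedOrdinaryLineAt_three_adicCompletionPrime_of_mult_twist_model` /
  `twistedOrdinaryLineAt_three_inertia_of_mult_twist_model` — TB-TOL for `W = C • V^{(−3)}`, `V`
  multiplicative at `3`, AT THE PLACE; class forms `PotMult.twistedOrdinaryLineAt_three_inertia`,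
  `ClassX4M.twistedOrdinaryLineAt_three_inertia`, `ClassX3M.twistedOrdinaryLineAt_three_inertia`;
  O8-TAME at the place: `O8.inertiaSplitAt_three_inertia_of_potMult`,
  `inertiaSplitAt_three_inertia_of_classX4M_of_not_surj` (gen 7's `∃ 𝔓` forms sharpened to the
  given `v`); and gen 6's mixed-congruence lemma with a multiplicative partner at the place:
  `inertiaSplitAt_adicCompletionPrime_of_congruence_of_multiplicative`.
* §2 (namespace `…AdditivePotMult`, next to p12's FILE 6 §3): the (M) TWINS of FILE 7 —
  **`PotMult.exists_isRamifiedOrdinaryLine_flipped_three`**,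
  **`ClassX4M.exists_isRamifiedOrdinaryLine_flipped_three`**,
  **`ClassX3M.exists_isRamifiedOrdinaryLine_flipped_three`**: at `v ∋ 3` a ramified ordinary line
  `C` with `(E[3^∞]/C)^{ker κ ⊓ I_v} = 0`, `I_v` FIXING `C ∩ E[3]` pointwise, and `E[3]^{I_v} ⊆ C`
  (mod A40/A41), for every `ℤ_3`-extension `κ`.

NOT here: the GV transfer COUNT on (M) pairs (the twin of p12's FILE 8) — sequel file
`AdditivePotMult/GreenbergVatsalTransferCountThreePotMult`; anything about `Sel`/BSD; any mark.

References: [GreenbergVatsal2000] §2 Remark (2.9), pp. 14–15 and p. 26; [Serre1972] §1.11 Prop. 11,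
§2.4 Prop. 15; [SilvermanATAEC1994] V.5.3, V.5.4 (Tate uniformisation); [Lang1983] Ch. 6 Prop. 1.3
(Kummer); Neukirch ANT II (9.6); class-closure/O8/STATEMENT.md §13, N11/STATEMENT.md.
-/

set_option autoImplicit false

noncomputable section

open scoped Classical NumberField AddSubgroup

open NumberField IsDedekindDomain Field WeierstrassCurve
  Literature.NumberTheory.GaloisRepresentations Literature.NumberTheory.EllipticCurves
  Literature.NumberTheory.EllipticCurves.GreenbergSelmer
  Literature.NumberTheory.EllipticCurves.GreenbergVatsal2000
  Literature.NumberTheory.EllipticCurves.EmertonPollackWeston2006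
  Literature.NumberTheory.EllipticCurves.Rank1Residual
  Summit.BirchSwinnertonDyer.Rank1Residual.X2.TorsionComparison
  Summit.BirchSwinnertonDyer.Rank1Residual.X2.GreenbergVatsalTorsion
  Summit.BirchSwinnertonDyer.Rank1Residual.X2.GreenbergVatsalTateDatumCofree
  Summit.BirchSwinnertonDyer.Rank1Residual.GaloisImage

universe u

/-! ### §1 The Tate line and TB-TOL AT THE PLACE `v` -/

namespace Summit.BirchSwinnertonDyer.Rank1Residual.Additive.MixedCongruence

section TateLineAtPlace

variable {W' : WeierstrassCurve ℚ} [W'.IsElliptic] [W'.IsGloballyMinimal] {p : ℕ} [hp : Fact p.Prime]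

/-- **The Tate line AT THE PLACE.** `E'/ℚ` globally minimal, multiplicative at the odd prime `p`
(Tate uniformisation A40/A41 granted): for EVERY place `v ∋ p`, at the inertia group of the tree's
prime `𝔓₀ = adicCompletionPrime ℚ v`, `E'[p]` has the unramified-quotient shape — a line `X` of order
`p` with `(σ − 1)E'[p] ⊆ X` for `σ ∈ I_{𝔓₀}` (X2's `exists_line_adicCompletionPrime_of_datum` on the
Tate data `exists_data_of_split` / `exists_data_of_not_split`; gen 6's `∃ v ∃ 𝔓` form, sharpened).
[cite: SilvermanATAEC1994, Thm. V.5.3 and Cor. V.5.4] [cite: GreenbergVatsal2000, §2 pp. 14–15] -/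
theorem unramifiedQuotientLineAt_adicCompletionPrime_of_multiplicative
    (hT : Silverman1994_thmV53_tateUniformisation.{0})
    (hT' : Silverman1994_thmV53_corV54_tateUniformisation.{0})
    (hp2 : p ≠ 2) (hmult : W'.HasMultiplicativeReductionAtPrime p)
    {v : HeightOneSpectrum (𝓞 ℚ)} (hv : ((p : ℕ) : 𝓞 ℚ) ∈ v.asIdeal) :
    UnramifiedQuotientLineAt W' p ((adicCompletionPrime ℚ v).inertia (absoluteGaloisGroup ℚ)) := by
  obtain ⟨κ, hκ, -⟩ := exists_isCyclotomic_isTopGenerator_isCyclotomicVariable_holds p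
  by_cases hsplit : W'.HasSplitMultiplicativeReductionAtPrime p
  · obtain ⟨L, htriv, hgen, hC, -⟩ := exists_data_of_split W' p κ hT hp2 hsplit
    obtain ⟨X, hX, hsub, -⟩ := X2.IsogenyLineType.exists_line_adicCompletionPrime_of_datum W' p hv
      (L v hv) (htriv v hv) (hgen v hv) (hC v hv).2
    exact ⟨X, hX, hsub⟩
  · obtain ⟨L, htriv, hgen, hC, -⟩ := exists_data_of_not_split W' p κ hT' hκ hp2 hmult hsplit
    obtain ⟨X, hX, hsub, -⟩ := X2.IsogenyLineType.exists_line_adicCompletionPrime_of_datum W' p hv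
      (L v hv) (htriv v hv) (hgen v hv) (hC v hv).2
    exact ⟨X, hX, hsub⟩

/-- **The Tate line at `inertia v`** (Neukirch II (9.6): `inertia v = I_{adicCompletionPrime ℚ v}`).
[cite: SilvermanATAEC1994, Thm. V.5.3 and Cor. V.5.4] -/
theorem unramifiedQuotientLineAt_inertia_of_multiplicative
    (hT : Silverman1994_thmV53_tateUniformisation.{0})
    (hT' : Silverman1994_thmV53_corV54_tateUniformisation.{0})
    (hp2 : p ≠ 2) (hmult : W'.HasMultiplicativeReductionAtPrime p)
    {v : HeightOneSpectrum (𝓞 ℚ)} (hv : ((p : ℕ) : 𝓞 ℚ) ∈ v.asIdeal) :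
    UnramifiedQuotientLineAt W' p (inertia v) := by
  have h := unramifiedQuotientLineAt_adicCompletionPrime_of_multiplicative hT hT' hp2 hmult hv
  rwa [inertia_adicCompletionPrime_eq_map_absInertia] at h

variable {W : WeierstrassCurve ℚ}

/-- **Mixed congruence with a MULTIPLICATIVE partner, AT THE PLACE** (gen 6's
`exists_inertiaSplitAt_of_congruence_of_multiplicative` with `∃ v ∃ 𝔓` replaced by the given `v` and
`𝔓₀ = adicCompletionPrime ℚ v`): `E'` globally minimal, multiplicative at the odd `p` (A40/A41);
`E[p] ≃ E'[p]` `Γ_ℚ`-equivariantly; `E[p]` of twisted-ordinary shape at `I_{𝔓₀}`: BOTH `E'[p]|_{I_{𝔓₀}}`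
and `E[p]|_{I_{𝔓₀}}` split. [cite: SilvermanATAEC1994, Thm. V.5.3 and Cor. V.5.4]
[cite: Edixhoven1997Serre, §4.2 (PDF p. 297; companion forms)] -/
theorem inertiaSplitAt_adicCompletionPrime_of_congruence_of_multiplicative [W.IsElliptic]
    (hT : Silverman1994_thmV53_tateUniformisation.{0})
    (hT' : Silverman1994_thmV53_corV54_tateUniformisation.{0})
    (hp2 : p ≠ 2) (hmult : W'.HasMultiplicativeReductionAtPrime p)
    (e : geomTorsion W (p : ℤ) ≃+ geomTorsion W' (p : ℤ))
    (he : ∀ (σ : absoluteGaloisGroup ℚ) (P : geomTorsion W (p : ℤ)), e (σ • P) = σ • e P)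
    {v : HeightOneSpectrum (𝓞 ℚ)} (hv : ((p : ℕ) : 𝓞 ℚ) ∈ v.asIdeal)
    (hE : TwistedOrdinaryLineAt W p ((adicCompletionPrime ℚ v).inertia (absoluteGaloisGroup ℚ))) :
    InertiaSplitAt W' p ((adicCompletionPrime ℚ v).inertia (absoluteGaloisGroup ℚ)) ∧
      InertiaSplitAt W p ((adicCompletionPrime ℚ v).inertia (absoluteGaloisGroup ℚ)) :=
  have hA := unramifiedQuotientLineAt_adicCompletionPrime_of_multiplicative hT hT' hp2 hmult hv
  ⟨inertiaSplitAt_of_congruence _ e he hE hA, inertiaSplitAt_of_congruence_left _ e he hE hA⟩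

/-- **TB-TOL on the (M) rows, AT THE PLACE.** `V` globally minimal and MULTIPLICATIVE at `3` (Tate
uniformisation A40/A41 granted), `W = C • V^{(−3)}`: for EVERY place `v ∋ 3`, at the inertia group of
`𝔓₀ = adicCompletionPrime ℚ v`, `W[3]` has the twisted-ordinary shape (X2's Tate line of `V` at the
place + the Kummer inertia element `σ√−3 = −√−3` at `𝔓₀ ∈ v.primesAbove`). Gen 7's
`exists_twistedOrdinaryLineAt_three_of_mult_twist_model`, sharpened from `∃ v ∃ 𝔓` to the given `v`.
[cite: SilvermanATAEC1994, V.5.3 and V.5.4 (Tate uniformisation)] [cite: Lang1983, Ch. 6 Prop. 1.3] -/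
theorem twistedOrdinaryLineAt_three_adicCompletionPrime_of_mult_twist_model {V : WeierstrassCurve ℚ}
    [V.IsElliptic] [V.IsGloballyMinimal]
    (hT : Silverman1994_thmV53_tateUniformisation.{0})
    (hT' : Silverman1994_thmV53_corV54_tateUniformisation.{0})
    (hmult : V.HasMultiplicativeReductionAtPrime 3)
    (C : VariableChange ℚ) (hC : C • V.quadraticTwist (-3 : ℚ) = W)
    {v : HeightOneSpectrum (𝓞 ℚ)} (hv : ((3 : ℕ) : 𝓞 ℚ) ∈ v.asIdeal) :
    TwistedOrdinaryLineAt W 3 ((adicCompletionPrime ℚ v).inertia (absoluteGaloisGroup ℚ)) := by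
  refine twistedOrdinaryLineAt_three_of_twist_model C hC ?_
    (unramifiedQuotientLineAt_adicCompletionPrime_of_multiplicative hT hT' (by decide) hmult hv)
  -- the Kummer inertia element at `𝔓₀ = adicCompletionPrime ℚ v`
  have hγ : v.intValuation (((-3 : ℤ) : 𝓞 ℚ)) = WithZero.exp (-1 : ℤ) := by
    have h := intValuation_pStar 3 hv
    have e1 : ((((-1 : ℤ) ^ ((3 : ℕ) / 2) * (3 : ℕ) : ℤ)) : 𝓞 ℚ) = (((-3 : ℤ)) : 𝓞 ℚ) := by
      norm_num
    rwa [e1] at h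
  have h2 : (2 : 𝓞 ℚ) ∉ v.asIdeal := two_not_mem_of_natCast_prime_mem (Fact.out) (by decide) hv
  obtain ⟨σ, hσI, hσ⟩ :=
    exists_mem_inertia_smul_geomSqrt_eq_neg hγ h2 (adicCompletionPrime_mem_primesAbove ℚ v)
  have hcoe : ((((-3 : ℤ) : 𝓞 ℚ) : 𝓞 ℚ) : ℚ) = (-3 : ℚ) := by
    rw [RingOfIntegers.coe_eq_algebraMap, map_intCast]
    norm_num
  rw [hcoe] at hσ
  exact ⟨σ, hσI, hσ⟩

/-- **TB-TOL on the (M) rows at `inertia v`** — the shape p12's FILE 7 consumes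
(`forall_inertia_smul_torsionDatum_eq_of_twistedOrdinaryLineAt`).
[cite: SilvermanATAEC1994, V.5.3 and V.5.4 (Tate uniformisation)] [cite: Lang1983, Ch. 6 Prop. 1.3] -/
theorem twistedOrdinaryLineAt_three_inertia_of_mult_twist_model {V : WeierstrassCurve ℚ}
    [V.IsElliptic] [V.IsGloballyMinimal]
    (hT : Silverman1994_thmV53_tateUniformisation.{0})
    (hT' : Silverman1994_thmV53_corV54_tateUniformisation.{0})
    (hmult : V.HasMultiplicativeReductionAtPrime 3)
    (C : VariableChange ℚ) (hC : C • V.quadraticTwist (-3 : ℚ) = W)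
    {v : HeightOneSpectrum (𝓞 ℚ)} (hv : ((3 : ℕ) : 𝓞 ℚ) ∈ v.asIdeal) :
    TwistedOrdinaryLineAt W 3 (inertia v) := by
  have h := twistedOrdinaryLineAt_three_adicCompletionPrime_of_mult_twist_model hT hT' hmult C hC hv
  rwa [inertia_adicCompletionPrime_eq_map_absInertia] at h

/-- **TB-TOL on pot-mult(3), at `inertia v`** (mod A40/A41): `E/ℚ` potentially multiplicative at
`3` — the twist model is the tree's `PotMult.exists_mult_pStar_twist_model` (`p* = −3`).
[cite: SilvermanATAEC1994, V.5.3 and V.5.4 (Tate uniformisation)] [cite: Lang1983, Ch. 6 Prop. 1.3] -/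
theorem PotMult.twistedOrdinaryLineAt_three_inertia [W.IsElliptic]
    (hT : Silverman1994_thmV53_tateUniformisation.{0})
    (hT' : Silverman1994_thmV53_corV54_tateUniformisation.{0})
    (hpm : Summit.BirchSwinnertonDyer.Rank1Residual.AdditivePotMult.PotMult W 3)
    {v : HeightOneSpectrum (𝓞 ℚ)} (hv : ((3 : ℕ) : 𝓞 ℚ) ∈ v.asIdeal) :
    TwistedOrdinaryLineAt W 3 (inertia v) := by
  obtain ⟨V, iV, iVm, C, hmV, hC⟩ := hpm.exists_mult_pStar_twist_model (by decide)
  have h3 : ((-1 : ℚ) ^ ((3 : ℕ) / 2) * ((3 : ℕ) : ℚ)) = (-3 : ℚ) := by norm_num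
  rw [h3] at hC
  exact twistedOrdinaryLineAt_three_inertia_of_mult_twist_model hT hT' hmV C hC hv

/-- **TB-TOL on X4(M) at `3`, at `inertia v`** (mod A40/A41).
[cite: SilvermanATAEC1994, V.5.3 and V.5.4 (Tate uniformisation)] [cite: Lang1983, Ch. 6 Prop. 1.3] -/
theorem ClassX4M.twistedOrdinaryLineAt_three_inertia [W.IsElliptic]
    (hT : Silverman1994_thmV53_tateUniformisation.{0})
    (hT' : Silverman1994_thmV53_corV54_tateUniformisation.{0})
    (hX : Summit.BirchSwinnertonDyer.Rank1Residual.AdditivePotMult.ClassX4M W 3)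
    {v : HeightOneSpectrum (𝓞 ℚ)} (hv : ((3 : ℕ) : 𝓞 ℚ) ∈ v.asIdeal) :
    TwistedOrdinaryLineAt W 3 (inertia v) :=
  PotMult.twistedOrdinaryLineAt_three_inertia hT hT' hX.potMult hv

/-- **TB-TOL on X3♯(M) at `3`, at `inertia v`** (mod A40/A41; reducibility of `E[3]` irrelevant).
[cite: SilvermanATAEC1994, V.5.3 and V.5.4 (Tate uniformisation)] [cite: Lang1983, Ch. 6 Prop. 1.3] -/
theorem ClassX3M.twistedOrdinaryLineAt_three_inertia [W.IsElliptic] [W.IsGloballyMinimal]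
    (hT : Silverman1994_thmV53_tateUniformisation.{0})
    (hT' : Silverman1994_thmV53_corV54_tateUniformisation.{0})
    (hX : Summit.BirchSwinnertonDyer.Rank1Residual.AdditivePotMult.ClassX3M W 3)
    {v : HeightOneSpectrum (𝓞 ℚ)} (hv : ((3 : ℕ) : 𝓞 ℚ) ∈ v.asIdeal) :
    TwistedOrdinaryLineAt W 3 (inertia v) :=
  PotMult.twistedOrdinaryLineAt_three_inertia hT hT' hX.potMult hv

/-- **O8-TAME on pot-mult(3), AT THE PLACE** (mod A40/A41): an O8 pair at `3` (`ClassX4 W 3`,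
`¬ Surj W 3`) potentially multiplicative at `3` has `E[3]|_{I_v} ≅ χ ⊕ 1` SPLIT at `inertia v` for every
`v ∋ 3` — gen 7's `O8.exists_inertiaSplitAt_three_of_mult_twist_model`, sharpened to the given `v`.
[cite: SilvermanATAEC1994, V.5.3 and V.5.4 (Tate uniformisation)] [cite: Serre1972, §2.4 Prop. 15] -/
theorem O8.inertiaSplitAt_three_inertia_of_potMult [W.IsElliptic] (hX : ClassX4 W 3) (hns : ¬ Surj W 3)
    (hT : Silverman1994_thmV53_tateUniformisation.{0})
    (hT' : Silverman1994_thmV53_corV54_tateUniformisation.{0})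
    (hpm : Summit.BirchSwinnertonDyer.Rank1Residual.AdditivePotMult.PotMult W 3)
    {v : HeightOneSpectrum (𝓞 ℚ)} (hv : ((3 : ℕ) : 𝓞 ℚ) ∈ v.asIdeal) :
    InertiaSplitAt W 3 (inertia v) :=
  Additive.O8.inertiaSplitAt_of_twistedOrdinaryLineAt W 3 hX hns
    (PotMult.twistedOrdinaryLineAt_three_inertia hT hT' hpm hv)

/-- **O8 ∩ X4(M) at `3`: TAME at `inertia v` for every `v ∋ 3`, modulo Tate uniformisation only** —
gen 7's `exists_inertiaSplitAt_three_of_classX4M_of_not_surj`, sharpened to the given `v`.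
[cite: SilvermanATAEC1994, V.5.3 and V.5.4 (Tate uniformisation)] [cite: Serre1972, §2.4 Prop. 15] -/
theorem inertiaSplitAt_three_inertia_of_classX4M_of_not_surj [W.IsElliptic]
    (hX : Summit.BirchSwinnertonDyer.Rank1Residual.AdditivePotMult.ClassX4M W 3) (hns : ¬ Surj W 3)
    (hT : Silverman1994_thmV53_tateUniformisation.{0})
    (hT' : Silverman1994_thmV53_corV54_tateUniformisation.{0})
    {v : HeightOneSpectrum (𝓞 ℚ)} (hv : ((3 : ℕ) : 𝓞 ℚ) ∈ v.asIdeal) :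
    InertiaSplitAt W 3 (inertia v) :=
  O8.inertiaSplitAt_three_inertia_of_potMult hX.classX4 hns hT hT' hX.potMult hv

end TateLineAtPlace

end Summit.BirchSwinnertonDyer.Rank1Residual.Additive.MixedCongruence

/-! ### §2 The (M)-row TWINS of p12's FILE 7: the flipped line with all four local hypotheses -/

namespace Summit.BirchSwinnertonDyer.Rank1Residual.AdditivePotMult

open Summit.BirchSwinnertonDyer.Rank1Residual.Additive
  Summit.BirchSwinnertonDyer.Rank1Residual.Additive.MixedCongruence

section Three

variable {W : WeierstrassCurve ℚ} [W.IsElliptic] (κ : ZpExtension ℚ 3) {v : HeightOneSpectrum (𝓞 ℚ)}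

/-- **pot-mult(3): a ramified ordinary line `C` at `v ∋ 3` with `(E[3^∞]/C)^{ker κ ⊓ I_v} = 0`,
`I_v` FIXING `C ∩ E[3]` pointwise, and `E[3]^{I_v} ⊆ C`** (mod A40/A41; every `ℤ_3`-extension `κ`)
— the four local hypotheses `h0 / hplus / hfix / hmax` of p12's
`GreenbergVatsalTorsionRamifiedQuotient` / `GreenbergVatsalTransferRamifiedQuotient` ALL discharged on
the pot-mult(3) rows: `h0` = p12's FILE 6 `PotMult.exists_isRamifiedOrdinaryLine_gr_invariants_eq_zero`,
`hfix` = FILE 7's `forall_inertia_smul_torsionDatum_eq_of_twistedOrdinaryLineAt` fed by §1's TB-TOL at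
`inertia v`, `hmax` = FILE 7's `mem_torsionDatum_plus_of_forall_inertia_smul_eq`. Nothing booked.
[cite: GreenbergVatsal2000, §2 Remark (2.9) and p. 26] [cite: Serre1972, §1.11 Prop. 11]
[cite: SilvermanATAEC1994, V.5.3 and V.5.4 (Tate uniformisation)] -/
theorem PotMult.exists_isRamifiedOrdinaryLine_flipped_three
    (hT40 : Silverman1994_thmV53_tateUniformisation.{0})
    (hT41 : Silverman1994_thmV53_corV54_tateUniformisation.{0}) (hpm : PotMult W 3)
    (hpv : ((3 : ℕ) : 𝓞 ℚ) ∈ v.asIdeal) :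
    ∃ L : LocalDatum ℚ ↥(W.geomPrimaryTorsion 3) v, IsRamifiedOrdinaryLine W 3 L ∧
      (∀ a ∈ invariants (inertiaIn κ.kerSubgroup v) L.Gr, a = 0) ∧
      (∀ τ ∈ inertia v, ∀ c ∈ (torsionDatum L 3).plus, τ • c = c) ∧
      (∀ x : (W.geomPrimaryTorsion 3)[((3 : ℕ) : ℤ)], (∀ τ ∈ inertia v, τ • x = x) →
        x ∈ (torsionDatum L 3).plus) := by
  obtain ⟨L, hL, h0⟩ :=
    hpm.exists_isRamifiedOrdinaryLine_gr_invariants_eq_zero κ hT40 hT41 (by decide) hpv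
  have hT : TwistedOrdinaryLineAt W 3 (inertia v) :=
    PotMult.twistedOrdinaryLineAt_three_inertia hT40 hT41 hpm hpv
  exact ⟨L, hL, h0,
    forall_inertia_smul_torsionDatum_eq_of_twistedOrdinaryLineAt L hT (fun _ hm ↦ hL.divisible hm)
      hL.plus_ne_top _ h0,
    fun x hx ↦ mem_torsionDatum_plus_of_forall_inertia_smul_eq L _ h0 x hx⟩

/-- **X4(M) at `3`: the (M) TWIN of p12's `ClassX4Gord.exists_isRamifiedOrdinaryLine_flipped_three`**
(mod A40/A41): a ramified ordinary line `C` at `v ∋ 3` with `(E[3^∞]/C)^{ker κ ⊓ I_v} = 0`, `I_v`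
FIXING `C ∩ E[3]` pointwise, and `E[3]^{I_v} ⊆ C`. X4(M) stays CONSTRUCTION-SHAPED; nothing booked.
[cite: GreenbergVatsal2000, §2 Remark (2.9) and p. 26] [cite: Serre1972, §1.11 Prop. 11]
[cite: SilvermanATAEC1994, V.5.3 and V.5.4 (Tate uniformisation)] -/
theorem ClassX4M.exists_isRamifiedOrdinaryLine_flipped_three
    (hT40 : Silverman1994_thmV53_tateUniformisation.{0})
    (hT41 : Silverman1994_thmV53_corV54_tateUniformisation.{0}) (hX : ClassX4M W 3)
    (hpv : ((3 : ℕ) : 𝓞 ℚ) ∈ v.asIdeal) :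
    ∃ L : LocalDatum ℚ ↥(W.geomPrimaryTorsion 3) v, IsRamifiedOrdinaryLine W 3 L ∧
      (∀ a ∈ invariants (inertiaIn κ.kerSubgroup v) L.Gr, a = 0) ∧
      (∀ τ ∈ inertia v, ∀ c ∈ (torsionDatum L 3).plus, τ • c = c) ∧
      (∀ x : (W.geomPrimaryTorsion 3)[((3 : ℕ) : ℤ)], (∀ τ ∈ inertia v, τ • x = x) →
        x ∈ (torsionDatum L 3).plus) :=
  (ClassX4M.potMult W 3 hX).exists_isRamifiedOrdinaryLine_flipped_three κ hT40 hT41 hpv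

/-- **X3♯(M) at `3` (REDUCIBLE `E[3]`): the (M) TWIN of p12's
`ClassX3Gord.exists_isRamifiedOrdinaryLine_flipped_three`** (mod A40/A41) — the same four
conclusions. X3♯(M) stays as labelled; nothing booked.
[cite: GreenbergVatsal2000, §2 Remark (2.9) and p. 26] [cite: Serre1972, §1.11 Prop. 11]
[cite: SilvermanATAEC1994, V.5.3 and V.5.4 (Tate uniformisation)] -/
theorem ClassX3M.exists_isRamifiedOrdinaryLine_flipped_three [W.IsGloballyMinimal]
    (hT40 : Silverman1994_thmV53_tateUniformisation.{0})
    (hT41 : Silverman1994_thmV53_corV54_tateUniformisation.{0}) (hX : ClassX3M W 3)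
    (hpv : ((3 : ℕ) : 𝓞 ℚ) ∈ v.asIdeal) :
    ∃ L : LocalDatum ℚ ↥(W.geomPrimaryTorsion 3) v, IsRamifiedOrdinaryLine W 3 L ∧
      (∀ a ∈ invariants (inertiaIn κ.kerSubgroup v) L.Gr, a = 0) ∧
      (∀ τ ∈ inertia v, ∀ c ∈ (torsionDatum L 3).plus, τ • c = c) ∧
      (∀ x : (W.geomPrimaryTorsion 3)[((3 : ℕ) : ℤ)], (∀ τ ∈ inertia v, τ • x = x) →
        x ∈ (torsionDatum L 3).plus) :=
  (ClassX3M.potMult W 3 hX).exists_isRamifiedOrdinaryLine_flipped_three κ hT40 hT41 hpv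

end Three

end Summit.BirchSwinnertonDyer.Rank1Residual.AdditivePotMult

end
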